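import Summits.ResolutionOfSingularities.ResolutionOfSingularities.Theses.AbhyankarShadows
import Summits.ResolutionOfSingularities.ResolutionOfSingularities.Theorems.RegularBlowupsDesingularization
import Summits.ResolutionOfSingularities.ResolutionOfSingularities.Theorems.FrobeniusLadderFRationalResolutionQuadricConeResolution
import Literature.AlgebraicGeometry.Resolution.BlowupsIntegral
import Literature.AlgebraicGeometry.Resolution.BlowupsProperProofs
import Literature.AlgebraicGeometry.Resolution.ComponentGluing
import Literature.AlgebraicGeometry.Resolution.ProjectiveSpaceRegular

/-!
# Negative-lane lemmas for crux `PatchingPerfect` (stmt-ResolutionOfSingularities-16089), line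
# `birth`: which clauses of its two open stubs are load-bearing

The stubs of `Cruxes/PatchingPerfect/Lines/birth.lean` are typed over the predicates
`PrincipalizationAt k` (stub 1: on a regular integral separated `k`-scheme of finite type `U`,
every `I ≠ 0` is principalized by ONE blowing up `σ : Bl_Q U → U` with `V(Q) ⊆ V(I)`, regular
source and `I𝒪` an effective Cartier divisor) and `ExcAdmissibleAt k → SingAdmissibleAt k` (stub
2: exceptional-admissible ⇒ Sing-admissible regular blowing up of every blowing up `η : V → U`
of a regular `U` along `I ≠ 0`). Each clause dropped in turn (standing disprover, cdisprove g2,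
`Cruxes/PatchingPerfect/Disproof.lean` §4.3–§4.4; statements inlined, every witness explicit):

* stub 1, conclusion clause `IsEffectiveCartier (I.comap σ)` dropped — TRIVIAL over every field
  (`patchingPerfect_birth_principalization_noCartier_trivial`: `Q = ⊤`, `σ = 𝟙`);
* stub 1, conclusion clause `Scheme.IsRegular U'` dropped — a THEOREM over every field
  (`patchingPerfect_birth_principalization_noRegSource_holds`: `Q = I`, `σ = Bl_I U → U`, tree
  `blowup`); so the two clauses are each other's content;
* stub 1, hypothesis `Scheme.IsRegular U` dropped — FALSE over every field of positive
  characteristic (`patchingPerfect_birth_not_principalization_noRegBase`): the instance `I = ⊤`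
  forces `Q = ⊤`, an isomorphic blowing up, hence `U` regular
  (`isRegular_of_isBlowup_support_subset_top`), and the quadric cone `yz + x² = 0` is not (tree
  `FRationalResolution.suspension_not_isRegular`);
* stub 1, guard `I ≠ ⊥` — NOT load-bearing: the excluded instance `I = ⊥` is junk-TRUE
  (`patchingPerfect_birth_principalization_bot_instance`: `Q = ⊥`, whose blowing up is the EMPTY
  scheme, `isBlowup_bot_of_isEmpty`);
* stub 2, guard `I ≠ ⊥` — LOAD-BEARING and right in both predicates: dropped, each is FALSE over
  every field (`patchingPerfect_birth_not_singAdmissible_noNeBot`,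
  `patchingPerfect_birth_not_excAdmissible_noNeBot`: `U = Spec k`, `I = ⊥`, `V = ∅`, on which no
  ideal sheaf is `≠ ⊥`);
* stub 2, hypothesis `Scheme.IsRegular U` — load-bearing ASYMMETRICALLY: on the exceptional side
  the predicate becomes FALSE (`patchingPerfect_birth_not_excAdmissible_noRegBase`, cone with
  `I = ⊤`: `J` would be cosupported in `η⁻¹V(⊤) = ∅`), so the mutated stub is a vacuous trap; on
  the singular side it becomes EXACTLY strong blow-up resolution of every integral `k`-variety
  (`patchingPerfect_birth_singAdmissible_noRegBase_iff_blowupStrongRes`), which implies the crux's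
  consequent at `k` (`patchingPerfect_birth_resolves_of_blowupStrongRes`) — summit-strength.
-/

noncomputable section

set_option linter.dupNamespace false

open CategoryTheory CategoryTheory.Limits AlgebraicGeometry TopologicalSpace
open Literature.AlgebraicGeometry.Resolution
open Summit.ResolutionOfSingularities.ResolutionOfSingularities.Theorems

namespace Summit.ResolutionOfSingularities.ResolutionOfSingularities.Theorems.PatchingPerfect.Negative

/-! ## Ideal-sheaf and blow-up bookkeeping -/

/-- The support of the unit ideal sheaf is empty. [folklore] -/
theorem coe_support_top (X : Scheme.{0}) : (((⊤ : X.IdealSheafData).support : Set X)) = ∅ := by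
  rw [(Scheme.IdealSheafData.support_eq_bot_iff ⊤).mpr rfl, Closeds.coe_bot]

/-- On a non-empty scheme the unit ideal sheaf is not the zero ideal sheaf (their supports are
`∅` and everything). [folklore] -/
theorem top_ne_bot_idealSheafData (X : Scheme.{0}) [h : Nonempty X] :
    (⊤ : X.IdealSheafData) ≠ ⊥ := by
  intro htb
  have h1 := coe_support_top X
  rw [htb, Scheme.IdealSheafData.support_bot, Closeds.coe_top] at h1
  obtain ⟨x⟩ := h
  have hx : x ∈ (Set.univ : Set X) := trivial
  rw [h1] at hx
  exact hx

/-- An ideal sheaf with empty support is the unit ideal sheaf. [folklore] -/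
theorem eq_top_of_support_subset_empty {X : Scheme.{0}} {Q : X.IdealSheafData}
    (h : (Q.support : Set X) ⊆ ∅) : Q = ⊤ := by
  rw [← Scheme.IdealSheafData.support_eq_bot_iff]
  exact Closeds.ext (by rw [Closeds.coe_bot]; exact Set.subset_empty_iff.mp h)

/-- On an empty scheme every ideal sheaf is the zero one. [folklore] -/
theorem idealSheafData_eq_bot_of_isEmpty {V : Scheme.{0}} [IsEmpty V] (J : V.IdealSheafData) :
    J = ⊥ := by
  have h : ∀ I : V.IdealSheafData, I = ⊤ := fun I =>
    (Scheme.IdealSheafData.support_eq_bot_iff I).mp (Closeds.ext (Set.eq_empty_of_isEmpty _))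
  rw [h J, h ⊥]

/-- Regularity transports along an isomorphism of schemes. [folklore] -/
theorem isRegular_of_isIso {U' U : Scheme.{0}} (σ : U' ⟶ U) [IsIso σ] (h : Scheme.IsRegular U') :
    Scheme.IsRegular U := by
  intro x
  haveI := h ((inv σ).base x)
  exact IsRegularLocalRing.of_ringEquiv (asIso ((inv σ).stalkMap x)).commRingCatIsoToRingEquiv

/-- **A `V(⊤)`-supported regular blowing up exists only over a REGULAR scheme**: if `Q` has
support inside that of `⊤` and `Bl_Q U` is regular then `Q = ⊤`, the blowing up is an isomorphism
(`IsBlowup.isIso`) and `U` is regular. The mechanism behind every `I = ⊤` instance of the stubs.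
[cite: GortzWedhorn2020, (13.19) p. 413] -/
theorem isRegular_of_isBlowup_support_subset_top {U U' : Scheme.{0}} {Q : U.IdealSheafData}
    {σ : U' ⟶ U} (hQ : (Q.support : Set U) ⊆ ((⊤ : U.IdealSheafData).support : Set U))
    (hσ : IsBlowup σ Q) (hreg : Scheme.IsRegular U') : Scheme.IsRegular U := by
  rw [coe_support_top] at hQ
  obtain rfl := eq_top_of_support_subset_empty hQ
  haveI : IsIso σ := hσ.isIso isEffectiveCartier_top
  exact isRegular_of_isIso σ hreg

/-- If `f⁻¹V(⊥) = W` is an effective Cartier divisor then `W = ∅` (a local equation would be a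
regular element vanishing at every point, tree `nonempty_basicOpen_of_mem_nonZeroDivisors`).
[cite: GortzWedhorn2020, Def. 13.90] -/
theorem isEmpty_of_isEffectiveCartier_comap_bot {W U : Scheme.{0}} (f : W ⟶ U)
    (hf : IsEffectiveCartier ((⊥ : U.IdealSheafData).comap f)) : IsEmpty W := by
  by_contra hne
  rw [not_isEmpty_iff] at hne
  obtain ⟨x'⟩ := hne
  obtain ⟨V, hxV, g, hg, hV⟩ := hf x'
  obtain ⟨y, hy⟩ := nonempty_basicOpen_of_mem_nonZeroDivisors V hxV g hg
  have hyV : y ∈ (V : W.Opens) := W.basicOpen_le g hy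
  have hsupp : y ∈ (((⊥ : U.IdealSheafData).comap f).support : Set W) := by
    rw [Scheme.IdealSheafData.support_comap]
    change f.base y ∈ ((⊥ : U.IdealSheafData).support : Set U)
    rw [Scheme.IdealSheafData.support_bot]
    trivial
  rw [SetLike.mem_coe, Scheme.IdealSheafData.mem_support_iff_of_mem hyV, hV] at hsupp
  simp only [Scheme.mem_zeroLocus_iff, SetLike.mem_coe] at hsupp
  exact hsupp g (Ideal.mem_span_singleton_self g) hy

/-- **Any morphism from an empty scheme is a blowing up along the zero ideal sheaf** (so the
blowing up of `⊥` is `∅`). [cite: GortzWedhorn2020, Def. 13.90] -/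
theorem isBlowup_bot_of_isEmpty {E U : Scheme.{0}} [IsEmpty E] (e : E ⟶ U) :
    IsBlowup e (⊥ : U.IdealSheafData) := by
  refine ⟨fun x => isEmptyElim x, fun W f hf => ?_⟩
  haveI : IsEmpty W := isEmpty_of_isEffectiveCartier_comap_bot f hf
  exact ⟨(isInitialOfIsEmpty (X := W)).to E, (isInitialOfIsEmpty (X := W)).hom_ext _ _,
    fun g _ => (isInitialOfIsEmpty (X := W)).hom_ext _ _⟩

/-! ## Stub 1 (`PrincipalizationAt k`), clause by clause -/

/-- **(stub 1) the Cartier clause dropped: TRIVIAL over every field** (`Q = ⊤`, `σ = 𝟙 U`).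
[folklore] -/
theorem patchingPerfect_birth_principalization_noCartier_trivial (k : Type) [Field k] :
    ∀ (U : Scheme.{0}) (f : U ⟶ Spec (.of k)),
      IsSeparated f → LocallyOfFiniteType f → QuasiCompact f → IsIntegral U → Scheme.IsRegular U →
      ∀ I : U.IdealSheafData, I ≠ ⊥ →
        ∃ (Q : U.IdealSheafData) (U' : Scheme.{0}) (σ : U' ⟶ U),
          (Q.support : Set U) ⊆ I.support ∧ IsBlowup σ Q ∧ Scheme.IsRegular U' := by
  intro U f _ _ _ _ hUreg I _
  refine ⟨⊤, U, 𝟙 U, ?_, isBlowup_id_top U, hUreg⟩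
  rw [coe_support_top]
  exact Set.empty_subset _

/-- **(stub 1) regularity of the source dropped: a THEOREM over every field** (`Q = I`,
`σ = Bl_I U → U`, which exists — tree `blowup` — and makes `I𝒪` an effective Cartier divisor by
definition). [cite: GortzWedhorn2020, Def. 13.90 and Prop. 13.92] -/
theorem patchingPerfect_birth_principalization_noRegSource_holds (k : Type) [Field k] :
    ∀ (U : Scheme.{0}) (f : U ⟶ Spec (.of k)),
      IsSeparated f → LocallyOfFiniteType f → QuasiCompact f → IsIntegral U → Scheme.IsRegular U →
      ∀ I : U.IdealSheafData, I ≠ ⊥ →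
        ∃ (Q : U.IdealSheafData) (U' : Scheme.{0}) (σ : U' ⟶ U),
          (Q.support : Set U) ⊆ I.support ∧ IsBlowup σ Q ∧ IsEffectiveCartier (I.comap σ) :=
  fun _ _ _ _ _ _ _ I _ =>
    ⟨I, blowup I, blowup.π I, subset_rfl, blowup.isBlowup I, (blowup.isBlowup I).isEffectiveCartier⟩

/-- **(stub 1) mechanism of the hypothesis `IsRegular U`**: Axiom 4 asked WITHOUT it forces every
integral separated `k`-scheme of finite type to be regular (instance `I = ⊤`). [folklore] -/
theorem patchingPerfect_birth_isRegular_of_principalization_noRegBase {k : Type} [Field k]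
    (h : ∀ (U : Scheme.{0}) (f : U ⟶ Spec (.of k)),
      IsSeparated f → LocallyOfFiniteType f → QuasiCompact f → IsIntegral U →
      ∀ I : U.IdealSheafData, I ≠ ⊥ →
        ∃ (Q : U.IdealSheafData) (U' : Scheme.{0}) (σ : U' ⟶ U),
          (Q.support : Set U) ⊆ I.support ∧ IsBlowup σ Q ∧ Scheme.IsRegular U' ∧
            IsEffectiveCartier (I.comap σ))
    (U : Scheme.{0}) (f : U ⟶ Spec (.of k)) [IsSeparated f] [LocallyOfFiniteType f]
    [QuasiCompact f] [IsIntegral U] : Scheme.IsRegular U := by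
  obtain ⟨Q, U', σ, hQ, hσ, hreg, -⟩ := h U f ‹_› ‹_› ‹_› ‹_› ⊤ (top_ne_bot_idealSheafData U)
  exact isRegular_of_isBlowup_support_subset_top hQ hσ hreg

/-- **(stub 1) `Scheme.IsRegular U` is LOAD-BEARING: dropped, stub 1 is FALSE over every field of
positive characteristic** — witness the quadric cone `yz + x² = 0 ⊂ 𝔸³_k` (integral, affine of
finite type, not regular at the vertex: `x² ∈ 𝔪²`, tree `FRationalResolution.suspension_not_isRegular`)
with `I = ⊤`. [cite: Matsumura1987, Thm. 14.3] -/
theorem patchingPerfect_birth_not_principalization_noRegBase (k : Type) [Field k] (p : ℕ)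
    [Fact p.Prime] [CharP k p] :
    ¬ ∀ (U : Scheme.{0}) (f : U ⟶ Spec (.of k)),
      IsSeparated f → LocallyOfFiniteType f → QuasiCompact f → IsIntegral U →
      ∀ I : U.IdealSheafData, I ≠ ⊥ →
        ∃ (Q : U.IdealSheafData) (U' : Scheme.{0}) (σ : U' ⟶ U),
          (Q.support : Set U) ⊆ I.support ∧ IsBlowup σ Q ∧ Scheme.IsRegular U' ∧
            IsEffectiveCartier (I.comap σ) := by
  intro h
  have hg : (MvPolynomial.X 0 ^ 2 : MvPolynomial (Fin 1) k) ≠ 0 :=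
    pow_ne_zero _ (MvPolynomial.X_ne_zero 0)
  let R : Type := MvPolynomial (Fin 2 ⊕ Fin 1) k ⧸ Ideal.span
      {(MvPolynomial.X (Sum.inl 0) * MvPolynomial.X (Sum.inl 1) +
        MvPolynomial.rename Sum.inr (MvPolynomial.X 0 ^ 2) : MvPolynomial (Fin 2 ⊕ Fin 1) k)}
  let φ : Spec (.of R) ⟶ Spec (.of k) := Spec.map (CommRingCat.ofHom (algebraMap k R))
  obtain ⟨hsep, hft, hqc, -, -, -⟩ :=
    FRationalResolution.suspension_package k 1 (MvPolynomial.X 0 ^ 2) p hg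
  haveI := FRationalResolution.isPrime_span_suspension k 1 (MvPolynomial.X 0 ^ 2) hg
  haveI : IsDomain R := Ideal.Quotient.isDomain _
  haveI : IsSeparated φ := hsep
  haveI : LocallyOfFiniteType φ := hft
  haveI : QuasiCompact φ := hqc
  haveI : IsIntegral (Spec (.of R)) := inferInstance
  exact FRationalResolution.suspension_not_isRegular k 1 (MvPolynomial.X 0 ^ 2) p hg
    (Ideal.pow_mem_pow (Ideal.subset_span (Set.mem_range_self 0)) 2)
    (patchingPerfect_birth_isRegular_of_principalization_noRegBase h (Spec (.of R)) φ)

/-- **(stub 1) the guard `I ≠ ⊥` is NOT load-bearing**: the excluded instance `I = ⊥` of the body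
HOLDS (junk-true: blow up `Q = ⊥`, whose blowing up is the empty scheme — regular, and `⊥𝒪_∅` is an
effective Cartier divisor vacuously). [folklore] -/
theorem patchingPerfect_birth_principalization_bot_instance {U : Scheme.{0}} :
    ∃ (Q : U.IdealSheafData) (U' : Scheme.{0}) (σ : U' ⟶ U),
      (Q.support : Set U) ⊆ (⊥ : U.IdealSheafData).support ∧ IsBlowup σ Q ∧
        Scheme.IsRegular U' ∧ IsEffectiveCartier ((⊥ : U.IdealSheafData).comap σ) :=
  ⟨⊥, ∅, Scheme.emptyTo U, subset_rfl, isBlowup_bot_of_isEmpty _, fun x => isEmptyElim x,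
    fun x => isEmptyElim x⟩

/-! ## Stub 2 (`ExcAdmissibleAt k → SingAdmissibleAt k`), clause by clause -/

/-- **(stub 2) the guard `I ≠ ⊥` IS load-bearing in the Sing-admissible predicate: dropped, it is
FALSE over every field** — at `U = Spec k`, `I = ⊥`, the blowing up is `V = ∅`, on which no ideal
sheaf is `≠ ⊥`. [folklore] -/
theorem patchingPerfect_birth_not_singAdmissible_noNeBot (k : Type) [Field k] :
    ¬ ∀ (U V : Scheme.{0}) (f : U ⟶ Spec (.of k)) (η : V ⟶ U) (I : U.IdealSheafData),
      IsSeparated f → LocallyOfFiniteType f → QuasiCompact f → IsIntegral U → Scheme.IsRegular U →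
      IsBlowup η I →
        ∃ (J : V.IdealSheafData) (V' : Scheme.{0}) (π : V' ⟶ V),
          J ≠ ⊥ ∧ (∀ x : V, x ∈ J.support → ¬ IsRegularLocalRing (V.presheaf.stalk x)) ∧
            IsBlowup π J ∧ Scheme.IsRegular V' := by
  intro h
  obtain ⟨J, V', π, hJ, -, -, -⟩ := h (Spec (.of k)) ∅ (𝟙 _) (Scheme.emptyTo _) ⊥
    inferInstance inferInstance inferInstance inferInstance (Scheme.isRegular_Spec (.of k))
    (isBlowup_bot_of_isEmpty _)
  exact hJ (idealSheafData_eq_bot_of_isEmpty J)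

/-- **(stub 2) … and in the exceptional-admissible predicate likewise.** [folklore] -/
theorem patchingPerfect_birth_not_excAdmissible_noNeBot (k : Type) [Field k] :
    ¬ ∀ (U V : Scheme.{0}) (f : U ⟶ Spec (.of k)) (η : V ⟶ U) (I : U.IdealSheafData),
      IsSeparated f → LocallyOfFiniteType f → QuasiCompact f → IsIntegral U → Scheme.IsRegular U →
      IsBlowup η I →
        ∃ (J : V.IdealSheafData) (V' : Scheme.{0}) (π : V' ⟶ V),
          J ≠ ⊥ ∧ (J.support : Set V) ⊆ η ⁻¹' (I.support : Set U) ∧ IsBlowup π J ∧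
            Scheme.IsRegular V' := by
  intro h
  obtain ⟨J, V', π, hJ, -, -, -⟩ := h (Spec (.of k)) ∅ (𝟙 _) (Scheme.emptyTo _) ⊥
    inferInstance inferInstance inferInstance inferInstance (Scheme.isRegular_Spec (.of k))
    (isBlowup_bot_of_isEmpty _)
  exact hJ (idealSheafData_eq_bot_of_isEmpty J)

/-- **(stub 2, exceptional side) `Scheme.IsRegular U` is LOAD-BEARING: dropped, the
exceptional-admissible predicate is FALSE over every field of positive characteristic** (the
quadric cone with `I = ⊤`, `η = 𝟙`: `J` must be cosupported in `η⁻¹ V(⊤) = ∅`, so the regular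
blowing up is an isomorphism and the cone would be regular). Hence stub 2 with `IsRegular U`
dropped on both sides would hold VACUOUSLY — a trap. [cite: Matsumura1987, Thm. 14.3] -/
theorem patchingPerfect_birth_not_excAdmissible_noRegBase (k : Type) [Field k] (p : ℕ)
    [Fact p.Prime] [CharP k p] :
    ¬ ∀ (U V : Scheme.{0}) (f : U ⟶ Spec (.of k)) (η : V ⟶ U) (I : U.IdealSheafData),
      IsSeparated f → LocallyOfFiniteType f → QuasiCompact f → IsIntegral U →
      I ≠ ⊥ → IsBlowup η I →
        ∃ (J : V.IdealSheafData) (V' : Scheme.{0}) (π : V' ⟶ V),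
          J ≠ ⊥ ∧ (J.support : Set V) ⊆ η ⁻¹' (I.support : Set U) ∧ IsBlowup π J ∧
            Scheme.IsRegular V' := by
  intro h
  have hg : (MvPolynomial.X 0 ^ 2 : MvPolynomial (Fin 1) k) ≠ 0 :=
    pow_ne_zero _ (MvPolynomial.X_ne_zero 0)
  let R : Type := MvPolynomial (Fin 2 ⊕ Fin 1) k ⧸ Ideal.span
      {(MvPolynomial.X (Sum.inl 0) * MvPolynomial.X (Sum.inl 1) +
        MvPolynomial.rename Sum.inr (MvPolynomial.X 0 ^ 2) : MvPolynomial (Fin 2 ⊕ Fin 1) k)}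
  let φ : Spec (.of R) ⟶ Spec (.of k) := Spec.map (CommRingCat.ofHom (algebraMap k R))
  obtain ⟨hsep, hft, hqc, -, -, -⟩ :=
    FRationalResolution.suspension_package k 1 (MvPolynomial.X 0 ^ 2) p hg
  haveI := FRationalResolution.isPrime_span_suspension k 1 (MvPolynomial.X 0 ^ 2) hg
  haveI : IsDomain R := Ideal.Quotient.isDomain _
  haveI : IsIntegral (Spec (.of R)) := inferInstance
  obtain ⟨J, V', π, -, hJexc, hπ, hreg⟩ := h (Spec (.of R)) (Spec (.of R)) φ (𝟙 _) ⊤ hsep hft hqc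
    inferInstance (top_ne_bot_idealSheafData _) (isBlowup_id_top _)
  refine FRationalResolution.suspension_not_isRegular k 1 (MvPolynomial.X 0 ^ 2) p hg
    (Ideal.pow_mem_pow (Ideal.subset_span (Set.mem_range_self 0)) 2)
    (isRegular_of_isBlowup_support_subset_top (fun x hx => ?_) hπ hreg)
  have hx' := hJexc hx
  rw [coe_support_top, Set.preimage_empty] at hx'
  exact hx'.elim

/-- **(stub 2, singular side) dropping `Scheme.IsRegular U` from the Sing-admissible predicate
gives EXACTLY strong blow-up resolution of every integral `k`-variety** (→: `U := V`, `I = ⊤`,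
`η = 𝟙`; ←: a blowing up of an integral variety along `I ≠ 0` is an integral variety, tree
`IsBlowup.isIntegral` / `IsBlowup.isProper`). [folklore] -/
theorem patchingPerfect_birth_singAdmissible_noRegBase_iff_blowupStrongRes (k : Type) [Field k] :
    (∀ (U V : Scheme.{0}) (f : U ⟶ Spec (.of k)) (η : V ⟶ U) (I : U.IdealSheafData),
      IsSeparated f → LocallyOfFiniteType f → QuasiCompact f → IsIntegral U →
      I ≠ ⊥ → IsBlowup η I →
        ∃ (J : V.IdealSheafData) (V' : Scheme.{0}) (π : V' ⟶ V),
          J ≠ ⊥ ∧ (∀ x : V, x ∈ J.support → ¬ IsRegularLocalRing (V.presheaf.stalk x)) ∧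
            IsBlowup π J ∧ Scheme.IsRegular V') ↔
    (∀ (V : Scheme.{0}) (g : V ⟶ Spec (.of k)), IsSeparated g → LocallyOfFiniteType g →
      QuasiCompact g → IsIntegral V →
        ∃ (J : V.IdealSheafData) (V' : Scheme.{0}) (π : V' ⟶ V),
          J ≠ ⊥ ∧ (∀ x : V, x ∈ J.support → ¬ IsRegularLocalRing (V.presheaf.stalk x)) ∧
            IsBlowup π J ∧ Scheme.IsRegular V') := by
  refine ⟨fun h V g hs hl hq hV => ?_, fun h U V f η I hs hl hq hU hI hη => ?_⟩
  · haveI := hV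
    exact h V V g (𝟙 V) ⊤ hs hl hq hV (top_ne_bot_idealSheafData V) (isBlowup_id_top V)
  · haveI := hs; haveI := hl; haveI := hq; haveI := hU
    haveI : IsLocallyNoetherian U := LocallyOfFiniteType.isLocallyNoetherian f
    haveI : IsIntegral V := hη.isIntegral hI
    haveI : IsProper η := hη.isProper
    exact h V (η ≫ f) inferInstance inferInstance inferInstance inferInstance

/-- **(stub 2, singular side, consequence) strong blow-up resolution of integral `k`-varieties
gives the crux's consequent at `k`** (weak resolution of every reduced separated `k`-scheme of
finite type: a blowing up along `J ≠ 0` of an integral variety is proper and birational, tree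
`IsBlowup.isProper` / `IsBlowup.isBirational'`; components by
`ComponentGluing.hasResolution_of_forall_closeds`). So on the singular side `IsRegular U` is what
keeps the atom below the strong summit slice. [folklore] -/
theorem patchingPerfect_birth_resolves_of_blowupStrongRes (k : Type) [Field k]
    (h : ∀ (V : Scheme.{0}) (g : V ⟶ Spec (.of k)), IsSeparated g → LocallyOfFiniteType g →
      QuasiCompact g → IsIntegral V →
        ∃ (J : V.IdealSheafData) (V' : Scheme.{0}) (π : V' ⟶ V),
          J ≠ ⊥ ∧ (∀ x : V, x ∈ J.support → ¬ IsRegularLocalRing (V.presheaf.stalk x)) ∧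
            IsBlowup π J ∧ Scheme.IsRegular V') :
    ∀ (X : Scheme.{0}) (f : X ⟶ Spec (.of k)), IsSeparated f → LocallyOfFiniteType f →
      QuasiCompact f → IsReduced X → Scheme.HasResolution X := by
  intro X f hs hl hq hr
  haveI := hs; haveI := hl; haveI := hq; haveI := hr
  refine ComponentGluing.hasResolution_of_forall_closeds X f fun Z hZ => ?_
  haveI := hZ
  obtain ⟨J, V', π, hJ, -, hπ, hreg⟩ := h _ ((Scheme.IdealSheafData.vanishingIdeal Z).subschemeι ≫ f)
    inferInstance inferInstance inferInstance hZ
  haveI : IsLocallyNoetherian (Scheme.IdealSheafData.vanishingIdeal Z).subscheme :=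
    LocallyOfFiniteType.isLocallyNoetherian ((Scheme.IdealSheafData.vanishingIdeal Z).subschemeι ≫ f)
  haveI : IsProper π := hπ.isProper
  exact ⟨V', π, ⟨inferInstance, hπ.isBirational' hJ, hreg⟩⟩

end Summit.ResolutionOfSingularities.ResolutionOfSingularities.Theorems.PatchingPerfect.Negative

end
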